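import Summits.NavierStokesRegularity.NavierStokesRegularity.Theses.QuantisedSymmetry
import Summits.NavierStokesRegularity.NavierStokesRegularity.Theorems.BlowupAssembly

/-!
# Route `QuantisedSymmetry` — `Assembly` (item stmt-NavierStokesRegularity-11294)

Pure logic: the route statements of `QuantisedSymmetry`, in the antecedent order

  `PolyhedralDssProfileExists → PolyhedralTruncationBridge → ClayUniqueness → ¬ NavierStokesRegularity`,

refute Clay (A). This is, hypothesis for hypothesis, the type of the route's deciding theorem
`Summit.NavierStokesRegularity.NavierStokesRegularity.Theses.QuantisedSymmetry.closes` (rev 2); the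
proof below does not invoke `closes`, so that it depends only on the item definitions and on the
already-landed rank-1 glue `Literature.NS.blowup_assembly` of route `Blowup`
(`(X5a ∧ X5b) → ¬ NavierStokesRegularity`, file `Theorems/BlowupAssembly.lean`).

Argument. Unpack the polyhedral profile `(G, λ, u)` from `PolyhedralDssProfileExists`; the
per-sector truncation bridge `PolyhedralTruncationBridge` turns it into a rapidly decaying datum
whose Leray–Hopf classical solution is maximal with finite lifespan `T` — literally the blow-up
statement `X5a` of route `Blowup`; together with `ClayUniqueness` (= `X5b`) this is the hypothesis
of `blowup_assembly` (Clay (A) applied to the datum gives a global smooth bounded-energy solution,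
`X5b` glues it to the blowing-up one on `[0, T)`, and its restriction to `[0, T + 1)` is a smooth
extension past `T`, contradicting maximality). Nothing here is new mathematics; the open content
lives in the cruxes.
-/

-- the summit namespace `…NavierStokesRegularity.NavierStokesRegularity…` is the tree convention (D-0017)
set_option linter.dupNamespace false

namespace Summit.NavierStokesRegularity.NavierStokesRegularity.Theorems

open Summit.NavierStokesRegularity.NavierStokesRegularity.Theses.QuantisedSymmetry

/-- **Assembly** (item stmt-NavierStokesRegularity-11294, route QuantisedSymmetry, rev 2):
`PolyhedralDssProfileExists → PolyhedralTruncationBridge → ClayUniqueness → ¬ NavierStokesRegularity`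
— pure logic: the polyhedral Type-I DSS profile, fed to the per-sector truncation bridge, yields a
maximal smooth Leray–Hopf solution with finite lifespan from a rapidly decaying datum (`X5a`),
which together with uniqueness in Fefferman's class (`ClayUniqueness` = `X5b`) refutes Clay (A) by
the rank-1 glue `Literature.NS.blowup_assembly` (Beale–Kato–Majda 1984, §1, maximal interval of
smooth existence). [folklore] -/
theorem quantisedSymmetry_assembly_proof :
    Summit.NavierStokesRegularity.NavierStokesRegularity.Theses.QuantisedSymmetry.Assembly := by
  unfold Assembly
  intro hX hB hU
  obtain ⟨G, hfin, hdet, hirr, c, hc, w, hanc, hmeas, hdss, hdec, heqv, hnt⟩ := hX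
  exact Literature.NS.blowup_assembly
    ⟨hB G hfin hdet hirr c hc w hanc hmeas hdss hdec heqv hnt, hU⟩

end Summit.NavierStokesRegularity.NavierStokesRegularity.Theorems
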